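import Summits.NavierStokesRegularity.NavierStokesRegularity.Theorems.TaoForcedUniqueness.Negative.SerrinEnstrophyEnergy

/-!
# KJ-6 (7/9): weak `L²`-continuity of the witness OFF the blow-up instant `T/2`, and `λ(t) → ∞` at `T/2`

Cell `ns-blowup`, seat `ns-blowup-refuter` (g10 blueprint, g11 kernel), KILLSHEET §XXIV rows KJ-6/KJ-7,
part 7/9 of the kernel certificate `¬ Literature.Analysis.FluidPDE.Sohr2001_serrinClass_enstrophyBound(_global)`
(final file `SohrSerrinEnstrophyCountableJunk.lean` in this directory, which carries the full account and the
classification). LABEL: refuter construction (explicit data + proved lemmas; no named facts, no `sorry`).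
WHAT THIS IS NOT: not Navier–Stokes evidence and not a statement about Sohr's printed theorem — a hygiene
refutation of two facts AS TYPED (slice-wise force class `MemLqLp 2 2`, one outer Bochner integral in the
weak form); nothing here mentions the summit.

Content: the density + uniform-approximation reduction of weak continuity against `w ∈ L²` to continuous
compactly supported fields (`uW_weak_continuousOn_of_compactSupport`); continuity of `λ²`, `λ` off `T/2`; weak
continuity of `t ↦ ∫⟪u t, ψ⟫` at every `t₀ ≠ T/2` by dominated convergence (`uW_weak_continuousAt_of_ne`);
`λ(t) → ∞` as `t → T/2`, `t ≠ T/2` (`tendsto_lam_atTop`); and the reduction of weak continuity AT `T/2` to the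
weak nullity of the concentrating dilates (`uW_weak_continuousAt_half_of_null`).
-/

noncomputable section

namespace Summit.NavierStokesRegularity.ForcedUniquenessHygiene.KJ6

open MeasureTheory Set Function Filter Topology Metric
open scoped ENNReal NNReal RealInnerProductSpace ContDiff Laplacian
open Literature.Analysis.FluidPDE Literature.Analysis.FunctionSpaces

variable {Pr : Profile} (J : JunkFamily Pr)

section Hyps
variable {P : ℕ → Set ℝ} {ℓ : ℝ → ℕ} {ν T : ℝ}

/-- Step (1) of OBLIGATION 3: weak continuity against every `w ∈ L²` follows from weak
continuity against continuous compactly supported `L²` fields — density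
(`MemLp.exists_hasCompactSupport_eLpNorm_sub_le`) and the uniform bound `‖u t‖₂ ≤ T‖U‖₂` on `(0,T]`
(`continuousOn_of_uniform_approx_of_continuousOn`). -/
theorem uW_weak_continuousOn_of_compactSupport
    (h : ∀ ψ : (EuclideanSpace ℝ (Fin 3)) → (EuclideanSpace ℝ (Fin 3)), Continuous ψ → HasCompactSupport ψ → MemLp ψ 2 volume →
      ContinuousOn (fun t => ∫ x, ⟪uW Pr T t x, ψ x⟫) (Ioc 0 T))
    (w : (EuclideanSpace ℝ (Fin 3)) → (EuclideanSpace ℝ (Fin 3))) (hw : MemLp w 2 volume) :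
    ContinuousOn (fun t => ∫ x, ⟪uW Pr T t x, w x⟫) (Ioc 0 T) := by
  refine continuousOn_of_uniform_approx_of_continuousOn fun u hu => ?_
  obtain ⟨ε, hε, hεu⟩ := Metric.mem_uniformity_dist.1 hu
  set NU := (eLpNorm Pr.U 2 volume).toReal with hNU
  have hNU0 : 0 ≤ NU := ENNReal.toReal_nonneg
  set δ : ℝ := ε / (2 * (|T| * NU + 1)) with hδ
  have hden : 0 < |T| * NU + 1 := by positivity
  have hδpos : 0 < δ := by positivity
  have hδne : ENNReal.ofReal δ ≠ 0 := by
    rw [Ne, ENNReal.ofReal_eq_zero, not_le]; exact hδpos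
  obtain ⟨ψ, hψc, hψε, hψcont, hψmem⟩ :=
    hw.exists_hasCompactSupport_eLpNorm_sub_le (by norm_num : (2 : ℝ≥0∞) ≠ ⊤) hδne
  refine ⟨fun t => ∫ x, ⟪uW Pr T t x, ψ x⟫, h ψ hψcont hψc hψmem, fun t ht => hεu ?_⟩
  rw [Real.dist_eq]
  have hu2 : MemLp (uW Pr T t) 2 volume := memLp_uW_slice_two T t
  have hwψ : MemLp (w - ψ) 2 volume := hw.sub hψmem
  have hsplit : (∫ x, ⟪uW Pr T t x, w x⟫) - ∫ x, ⟪uW Pr T t x, ψ x⟫ =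
      ∫ x, ⟪uW Pr T t x, (w - ψ) x⟫ := by
    rw [← integral_sub (integrable_inner_of_memLp_two hu2 hw) (integrable_inner_of_memLp_two hu2 hψmem)]
    refine integral_congr_ae (Eventually.of_forall fun x => ?_)
    simp only [Pi.sub_apply, inner_sub_right]
  show |(∫ x, ⟪uW Pr T t x, w x⟫) - ∫ x, ⟪uW Pr T t x, ψ x⟫| < ε
  rw [hsplit]
  have h1 : (eLpNorm (uW Pr T t) 2 volume).toReal ≤ |T| * NU := by
    have h2 : (eLpNorm (uW Pr T t) 2 volume).toReal ≤
        (ENNReal.ofReal |t| * eLpNorm Pr.U 2 volume).toReal :=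
      ENNReal.toReal_mono (ENNReal.mul_ne_top ENNReal.ofReal_ne_top
        (memLp_profile_two Pr).eLpNorm_ne_top) (eLpNorm_uW_two_le (Pr := Pr) T t)
    rw [ENNReal.toReal_mul, ENNReal.toReal_ofReal (abs_nonneg t)] at h2
    refine h2.trans (mul_le_mul_of_nonneg_right ?_ hNU0)
    rw [abs_of_pos ht.1]
    exact ht.2.trans (le_abs_self T)
  have h2 : (eLpNorm (w - ψ) 2 volume).toReal ≤ δ :=
    (ENNReal.toReal_mono ENNReal.ofReal_ne_top hψε).trans (by rw [ENNReal.toReal_ofReal hδpos.le])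
  calc |∫ x, ⟪uW Pr T t x, (w - ψ) x⟫|
      ≤ (eLpNorm (uW Pr T t) 2 volume).toReal * (eLpNorm (w - ψ) 2 volume).toReal :=
        abs_integral_inner_le_eLpNorm₂ hu2 hwψ
    _ ≤ |T| * NU * δ := mul_le_mul h1 h2 ENNReal.toReal_nonneg (by positivity)
    _ < ε := by
        have e1 : |T| * NU * δ = ε * (|T| * NU / (2 * (|T| * NU + 1))) := by
          rw [hδ]; ring
        rw [e1]
        refine mul_lt_of_lt_one_right hε ?_
        rw [div_lt_one (by positivity)]
        nlinarith [hNU0, abs_nonneg T]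

/-- `λ²` is continuous off `T/2`. -/
theorem continuousAt_lamSq {t₀ : ℝ} (h : t₀ ≠ T / 2) : ContinuousAt (lamSq T) t₀ := by
  have h1 : ContinuousAt (fun t : ℝ => |t - T / 2|) t₀ :=
    (continuous_abs.comp (continuous_id.sub continuous_const)).continuousAt
  have h2 : ContinuousAt (fun a : ℝ => a ^ (-(1 / 4 : ℝ))) (|t₀ - T / 2|) :=
    Real.continuousAt_rpow_const _ _ (Or.inl (abs_ne_zero.2 (sub_ne_zero.2 h)))
  have h3 : ContinuousAt (fun t : ℝ => |t - T / 2| ^ (-(1 / 4 : ℝ))) t₀ :=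
    ContinuousAt.comp (f := fun t : ℝ => |t - T / 2|) h2 h1
  show ContinuousAt (fun t => 1 + |t - T / 2| ^ (-(1 / 4 : ℝ))) t₀
  exact continuousAt_const.add h3

/-- `λ` is continuous off `T/2` (step (4) of OBLIGATION 3, the finite half). -/
theorem continuousAt_lam {t₀ : ℝ} (h : t₀ ≠ T / 2) : ContinuousAt (lam T) t₀ :=
  Real.continuous_sqrt.continuousAt.comp (continuousAt_lamSq h)

/-- Step (2) of OBLIGATION 3: OFF `T/2` the witness is weakly continuous against every
continuous compactly supported field — dominated convergence (`continuousAt_of_dominated`), the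
integrand being jointly continuous (`JunkBuild.continuous_dilate₂`, `continuousAt_lam`) and dominated on
`tsupport ψ ⊆ closedBall 0 R` by `(|t₀|+1) √Λ Λ (sup_{closedBall 0 (Λ R)} ‖U‖) ‖ψ x‖` while `λ(t) ≤ Λ`. -/
theorem uW_weak_continuousAt_of_ne {t₀ : ℝ} (h0 : t₀ ≠ T / 2) (ψ : (EuclideanSpace ℝ (Fin 3)) → (EuclideanSpace ℝ (Fin 3))) (hψ : Continuous ψ)
    (hψc : HasCompactSupport ψ) (hψ2 : MemLp ψ 2 volume) :
    ContinuousAt (fun t => ∫ x, ⟪uW Pr T t x, ψ x⟫) t₀ := by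
  obtain ⟨R, hR⟩ := hψc.isCompact.isBounded.subset_closedBall (0 : (EuclideanSpace ℝ (Fin 3)))
  set Λ := lam T t₀ + 1 with hΛ
  have hΛpos : 0 < Λ := by have := lam_pos T t₀; positivity
  obtain ⟨M, hM⟩ := (isCompact_closedBall (0 : (EuclideanSpace ℝ (Fin 3))) (Λ * R)).exists_bound_of_continuousOn
    Pr.smooth.continuous.continuousOn
  set M' := max M 0 with hM'
  have hM'0 : 0 ≤ M' := le_max_right _ _
  have e1 : ∀ᶠ t in 𝓝 t₀, t ≠ T / 2 := isOpen_ne.mem_nhds h0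
  have e2 : ∀ᶠ t in 𝓝 t₀, lam T t < Λ := (continuousAt_lam h0).eventually_lt_const (lt_add_one _)
  have e3 : ∀ᶠ t in 𝓝 t₀, |t| < |t₀| + 1 :=
    continuous_abs.continuousAt.eventually_lt_const (lt_add_one _)
  refine continuousAt_of_dominated
    (bound := fun x => (|t₀| + 1) * (Real.sqrt Λ * (Λ * M')) * ‖ψ x‖) ?_ ?_ ?_ ?_
  · exact Eventually.of_forall fun t => (memLp_uW_slice_two (Pr := Pr) T t).1.inner hψ2.1
  · filter_upwards [e1, e2, e3] with t ht1 ht2 ht3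
    refine Eventually.of_forall fun x => ?_
    by_cases hx : x ∈ tsupport ψ
    · have hxR : ‖x‖ ≤ R := mem_closedBall_zero_iff.1 (hR hx)
      have hl := lam_pos T t
      have hUx : ‖Pr.U (lam T t • x)‖ ≤ M' := by
        refine (hM _ ?_).trans (le_max_left _ _)
        rw [mem_closedBall_zero_iff, norm_smul, Real.norm_of_nonneg hl.le]
        exact mul_le_mul ht2.le hxR (norm_nonneg _) hΛpos.le
      calc ‖⟪uW Pr T t x, ψ x⟫‖ ≤ ‖uW Pr T t x‖ * ‖ψ x‖ := norm_inner_le_norm _ _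
        _ = |t| * (Real.sqrt (lam T t) * (lam T t * ‖Pr.U (lam T t • x)‖)) * ‖ψ x‖ := by
            rw [uW, if_neg ht1, Pi.smul_apply, norm_smul, JunkBuild.dilate_apply, norm_smul,
              norm_smul, Real.norm_eq_abs, Real.norm_of_nonneg (Real.sqrt_nonneg _),
              Real.norm_of_nonneg hl.le]
        _ ≤ (|t₀| + 1) * (Real.sqrt Λ * (Λ * M')) * ‖ψ x‖ := by
            have h4 : Real.sqrt (lam T t) ≤ Real.sqrt Λ := Real.sqrt_le_sqrt ht2.le
            have h5 : Real.sqrt (lam T t) * (lam T t * ‖Pr.U (lam T t • x)‖) ≤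
                Real.sqrt Λ * (Λ * M') :=
              mul_le_mul h4 (mul_le_mul ht2.le hUx (norm_nonneg _) hΛpos.le)
                (mul_nonneg hl.le (norm_nonneg _)) (Real.sqrt_nonneg _)
            exact mul_le_mul_of_nonneg_right
              (mul_le_mul ht3.le h5 (by positivity) (by positivity)) (norm_nonneg _)
    · have hψx : ψ x = 0 := image_eq_zero_of_notMem_tsupport hx
      rw [hψx, inner_zero_right, norm_zero]
      positivity
  · exact (hψ.integrable_of_hasCompactSupport hψc).norm.const_mul _
  · refine Eventually.of_forall fun x => ?_
    have hd : ContinuousAt (fun t => dilate (lam T t) Pr.U x) t₀ :=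
      (JunkBuild.continuous_dilate₂ Pr).continuousAt.comp
        ((continuousAt_lam h0).prodMk continuousAt_const)
    have hg : ContinuousAt (fun t => ⟪t • dilate (lam T t) Pr.U x, ψ x⟫) t₀ :=
      (continuousAt_id.smul hd).inner continuousAt_const
    refine hg.congr_of_eventuallyEq (e1.mono fun t ht => ?_)
    show ⟪uW Pr T t x, ψ x⟫ = ⟪t • dilate (lam T t) Pr.U x, ψ x⟫
    rw [uW, if_neg ht]
    rfl

/-- `λ(t) → ∞` as `t → T/2`, `t ≠ T/2` (step (4) of OBLIGATION 3, the blow-up half). -/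
theorem tendsto_lam_atTop : Tendsto (lam T) (𝓝[≠] (T / 2)) atTop := by
  have h1 : Tendsto (fun t : ℝ => |t - T / 2|) (𝓝[≠] (T / 2)) (𝓝[>] 0) := by
    refine tendsto_nhdsWithin_iff.2 ⟨?_, ?_⟩
    · have hc : Continuous fun t : ℝ => |t - T / 2| :=
        continuous_abs.comp (continuous_id.sub continuous_const)
      have h := hc.tendsto (T / 2)
      simp only [sub_self, abs_zero] at h
      exact tendsto_nhdsWithin_of_tendsto_nhds h
    · exact eventually_nhdsWithin_of_forall fun t ht => abs_pos.2 (sub_ne_zero.2 ht)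
  have h2 : Tendsto (fun t : ℝ => |t - T / 2| ^ (-(1 / 4 : ℝ))) (𝓝[≠] (T / 2)) atTop :=
    (tendsto_rpow_neg_nhdsGT_zero (by norm_num : (-(1 / 4 : ℝ)) < 0)).comp h1
  have h3 : Tendsto (lamSq T) (𝓝[≠] (T / 2)) atTop := tendsto_atTop_add_const_left _ 1 h2
  have h4 : Tendsto (fun x : ℝ => x ^ (1 / (2 : ℝ))) atTop atTop := tendsto_rpow_atTop (by norm_num)
  refine (h4.comp h3).congr fun t => ?_
  show lamSq T t ^ (1 / (2 : ℝ)) = lam T t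
  rw [lam, Real.sqrt_eq_rpow]

/-- Through `T/2`, REDUCED to the weak nullity of the concentrating dilates of the PROFILE (PROVED
reduction): if `∫⟪U_c, ψ⟫ → 0` as `c → ∞` then `t ↦ ∫⟪u t, ψ⟫` is continuous at `T/2` (value `0`),
since `∫⟪u t, ψ⟫ = t ∫⟪U_{λ(t)}, ψ⟫` off `T/2` and `λ(t) → ∞` (`tendsto_lam_atTop`). -/
theorem uW_weak_continuousAt_half_of_null (ψ : (EuclideanSpace ℝ (Fin 3)) → (EuclideanSpace ℝ (Fin 3)))
    (hnull : Tendsto (fun c => ∫ x, ⟪dilate c Pr.U x, ψ x⟫) atTop (𝓝 0)) :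
    ContinuousAt (fun t => ∫ x, ⟪uW Pr T t x, ψ x⟫) (T / 2) := by
  rw [← continuousWithinAt_compl_self, ContinuousWithinAt]
  have h0 : (∫ x, ⟪uW Pr T (T / 2) x, ψ x⟫) = 0 := by simp [uW]
  rw [h0]
  have h1 : Tendsto (fun t => t * ∫ x, ⟪dilate (lam T t) Pr.U x, ψ x⟫) (𝓝[≠] (T / 2))
      (𝓝 (T / 2 * 0)) :=
    (tendsto_id.mono_left nhdsWithin_le_nhds).mul (hnull.comp tendsto_lam_atTop)
  rw [mul_zero] at h1
  refine h1.congr' (eventually_nhdsWithin_of_forall fun t ht => ?_)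
  show t * ∫ x, ⟪dilate (lam T t) Pr.U x, ψ x⟫ = ∫ x, ⟪uW Pr T t x, ψ x⟫
  rw [uW, if_neg (show t ≠ T / 2 from ht)]
  simp only [Pi.smul_apply, real_inner_smul_left, integral_const_mul]

end Hyps

end Summit.NavierStokesRegularity.ForcedUniquenessHygiene.KJ6
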